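import Summits.QuantumFields.BalabanUV.Beta.GAN24.T2OfBracketCovariance

/-!
# `BalabanUV.Beta.GAN24.T2OfBracketBlockCovariance` — binder row G-an2-4 / (CONV-C), W-slot road «W3» (SKELETON-W3 v1.0 §8.3, ROW W3-F2a's
# TABLE), companion of `GAN24/T2OfBracketCovariance`: the SOURCE BRACKET `b♮_j` of the normalised Stage-B recursion is JOINTLY
# BLOCK-COVARIANT AS A WHOLE TABLE — `b♮_j κ (u + Lc•t) κ′ (u′ + Lc•t) = shiftK (−Lc•t) (b♮_j κ u κ′ u′)` — the `hcov` conjunct of the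
# `Zfree` predicate in the form landed by ROW W3-F3b (`TransportIrrelevant.hTirr_three_slot`, p213474:
# `Zfree X := (joint Lc-covariance of X) ∧ (∀ κ κ′ κ₁ κ₂, zmode Lc X κ κ′ (inl κ₁) (inl κ₂) = 0)`)

NOT IN PRINT; OUR BOOKKEEPING (G-an2-4 formalisation swarm, leaf prover `b2b-balaban-gan24-formalise-leaf-11`, gen 18; journal INTENT
«W3-FFCOV*» PART 4; plumbing for ROW W3-F2a / W3-F2b — NOT a row; module name PROVISIONAL — the row owner gan24-p1 may rename / re-home it).
HONEST FRAMING (cell contract, verbatim): «discharging `BetaPertH` makes Bałaban's UV stability UNCONDITIONAL — a real constructive-QFT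
result; it is NOT the continuum limit and NOT the Clay problem.»  HONEST DEPENDENCY (verbatim): «continuum YM on T⁴ ⇐ BetaPertH ∧ nine spine
estimates (0/9 proved); BetaPertH ⇐ (D1) ∧ (D4) ∧ CAP+tail; G-an2-4 gates asym, D1 and NE2/3/4.»

WHY.  leaf-19's `T2SlotCovariance` (p212792 / v1.1) supplies the joint `Lc`-covariance of the normalised members `T♮_j`, of the first
differences `D n` and of the Cauchy differences; ROW W3-F2a's table is the bracket `b♮_j` (leaf-04's `T2RecursionAffine.unitS₂_T2Of_succ_affine`),
whose joint `Lc`-covariance is NOT among those: it follows at once from `T2OfBracketCovariance.bracketVal_translate` (the value part is covariant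
under ALL unit translations, a fortiori under `Lc•t`) and the border binder's block covariance `hBt` through `StepJetData.mfNeg_shiftK`, glued by
leaf-19's `smul_translate` / `add_translate` at `(w, v) = (Lc•t, −Lc•t)`.

WHAT ([folklore]; generic `d`, `1 ≤ Lc`, every `j`, colour constants SYMBOLIC; 0 `def`, 0 cite, 0 `def … : Prop`, 0 sorry):
* `border_translate_block` (`cB • (mfNeg ∘ vh₂S)` is jointly block-covariant under `hBt`), **`bracket_translate_block`** (the literal `b♮_j`,
  WHOLE table, under `hBt` and `hmixt` — no `hBff` needed), `bracket_translate_block_an1` (an1's `vh₂SAt ρ Lc` / `mixFFAt ρ′ Lc` at ANY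
  roots: NO binder left — `vh₂SAt_translate`, `mixFFAt_translate`), `bracket_translate_block_base` (the row's literal base-root text
  `vh₂S d Lc`, generic `mixFF` under `hmixt`).
Asserts NO zero-mode VALUE of the bracket (ROW W3-F2a, leaf-20's «W3-ZS*»); NOT a row of SKELETON-W3 §8.3; discharges NOTHING of «T2Shape» /
«T2SupRate» / (hW, hWall); 0/2 W wall binders; NOT «W-slot closed», NEVER «G-an2-4 closed», NOT (CONV-C); NOT BetaPertH, NOT continuum, NOT Clay.
-/

noncomputable section

open Literature.MathematicalPhysics.QuantumFieldTheory
open Literature.MathematicalPhysics.QuantumFieldTheory.Balaban1983to89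
open Literature.MathematicalPhysics.QuantumFieldTheory.Balaban1983to89.Beta
open ExpKernelCalculus (MKer shiftK)
open OneStepResolventKernel (Fib)
open OneStepKernelFamily (KInvStep)
open StepJetData (mfNeg mfNeg_shiftK)
open BalabanStepJetsSucc (mmRead)
open SecondOrderResponse (W2SymOfK)
open BalabanStepW2 (Spure M1 M2Of K3OfK)
open AveragingMixedJetTables (vh₂S vh₂SAt mixFFAt vh₂SAt_translate vh₂S_translate mixFFAt_translate)
open Summit.QuantumFields.BalabanUV.Beta.HessKerDressedUnits (unitK unitS)
open Summit.QuantumFields.BalabanUV.Beta.SecondOrderUnits (unitM unitM₂)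
open Summit.QuantumFields.BalabanUV.Beta.GAN24.CombesThomas (sfStep smStep)
open Summit.QuantumFields.BalabanUV.Beta.GAN24.BiStencilZeroMode (Tab)
open Summit.QuantumFields.BalabanUV.Beta.GAN24.T2SlotCovariance (smul_translate add_translate)
open Summit.QuantumFields.BalabanUV.Beta.GAN24.T2OfBracketCovariance (bracketVal_translate)

namespace Summit.QuantumFields.BalabanUV.Beta.GAN24.T2OfBracketBlockCovariance

variable {d : ℕ} {Lc : ℕ} [NeZero Lc]

section Generic

variable (hLc : 1 ≤ Lc) (cE cVH cΛ : ℝ) {mixFF : Tab d}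
  (hmixt : ∀ (κ : Fin (d + 1)) (u : Fin (d + 1) → ℤ) (ρ : Fin (d + 1)) (w t : Fin (d + 1) → ℤ),
    mixFF κ (u + (Lc : ℤ) • t) ρ (w + t) = shiftK (-((Lc : ℤ) • t)) (mixFF κ u ρ w))
  {vh₂S : Tab d}
  (hBt : ∀ (κ : Fin (d + 1)) (u : Fin (d + 1) → ℤ) (κ' : Fin (d + 1)) (u' t : Fin (d + 1) → ℤ),
    vh₂S κ (u + (Lc : ℤ) • t) κ' (u' + (Lc : ℤ) • t) = shiftK (-((Lc : ℤ) • t)) (vh₂S κ u κ' u'))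

include hBt in
omit [NeZero Lc] in
/-- [folklore] The border summand `cB • (mfNeg ∘ vh₂S)` is jointly block-covariant (`hBt` through `StepJetData.mfNeg_shiftK`, leaf-19's
`smul_translate`). -/
theorem border_translate_block (cB : ℝ) (t : Fin (d + 1) → ℤ) (κ : Fin (d + 1)) (u : Fin (d + 1) → ℤ) (κ' : Fin (d + 1))
    (u' : Fin (d + 1) → ℤ) :
    (fun κ u κ' u' => cB • mfNeg (vh₂S κ u κ' u')) κ (u + (Lc : ℤ) • t) κ' (u' + (Lc : ℤ) • t)
      = shiftK (-((Lc : ℤ) • t)) ((fun κ u κ' u' => cB • mfNeg (vh₂S κ u κ' u')) κ u κ' u') :=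
  smul_translate (w := (Lc : ℤ) • t) (v := -((Lc : ℤ) • t)) cB
    (A := fun κ u κ' u' => mfNeg (vh₂S κ u κ' u'))
    (fun κ u κ' u' => by
      show mfNeg (vh₂S κ (u + (Lc : ℤ) • t) κ' (u' + (Lc : ℤ) • t)) = shiftK (-((Lc : ℤ) • t)) (mfNeg (vh₂S κ u κ' u'))
      rw [hBt, mfNeg_shiftK]) κ u κ' u'

include hLc hmixt hBt in
/-- [folklore] **ROW W3-F2a's TABLE — THE LITERAL BRACKET `b♮_j` — IS JOINTLY BLOCK-COVARIANT AS A WHOLE TABLE**: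
`b♮_j κ (u + Lc•t) κ′ (u′ + Lc•t) = shiftK (−Lc•t) (b♮_j κ u κ′ u′)` — the `hcov` conjunct of ROW W3-F3b's landed `Zfree`
(`TransportIrrelevant.hTirr_three_slot`) for `X := b♮_j`.  Value part: `T2OfBracketCovariance.bracketVal_translate` at `t := Lc•t`; border:
`border_translate_block`; glued by leaf-19's `add_translate`. -/
theorem bracket_translate_block (cE₂ cB : ℝ) (j : ℕ) (κ : Fin (d + 1)) (u : Fin (d + 1) → ℤ) (κ' : Fin (d + 1))
    (u' t : Fin (d + 1) → ℤ) :
    (fun κ u κ' u' => (cE₂ * (Lc : ℝ) ^ (2 * (d + 1))) •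
          mmRead Lc (K3OfK (unitK (sfStep Lc j) (smStep d Lc j) (KInvStep (d := d) Lc j)) Lc
            (unitS (sfStep Lc j) (smStep d Lc j) (Spure d Lc cE cVH cΛ j)) (unitM (sfStep Lc j) (smStep d Lc j) (M1 d Lc cΛ j))
            (W2SymOfK (unitK (sfStep Lc j) (smStep d Lc j) (KInvStep (d := d) Lc j)) Lc
              (unitS (sfStep Lc j) (smStep d Lc j) (Spure d Lc cE cVH cΛ j)) (unitM (sfStep Lc j) (smStep d Lc j) (M1 d Lc cΛ j)) 0
              (unitM₂ (sfStep Lc j) (smStep d Lc j) (M2Of d Lc mixFF j))) κ u κ' u')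
        + cB • mfNeg (vh₂S κ u κ' u')) κ (u + (Lc : ℤ) • t) κ' (u' + (Lc : ℤ) • t)
      = shiftK (-((Lc : ℤ) • t)) ((fun κ u κ' u' => (cE₂ * (Lc : ℝ) ^ (2 * (d + 1))) •
          mmRead Lc (K3OfK (unitK (sfStep Lc j) (smStep d Lc j) (KInvStep (d := d) Lc j)) Lc
            (unitS (sfStep Lc j) (smStep d Lc j) (Spure d Lc cE cVH cΛ j)) (unitM (sfStep Lc j) (smStep d Lc j) (M1 d Lc cΛ j))
            (W2SymOfK (unitK (sfStep Lc j) (smStep d Lc j) (KInvStep (d := d) Lc j)) Lc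
              (unitS (sfStep Lc j) (smStep d Lc j) (Spure d Lc cE cVH cΛ j)) (unitM (sfStep Lc j) (smStep d Lc j) (M1 d Lc cΛ j)) 0
              (unitM₂ (sfStep Lc j) (smStep d Lc j) (M2Of d Lc mixFF j))) κ u κ' u')
        + cB • mfNeg (vh₂S κ u κ' u')) κ u κ' u') :=
  add_translate (w := (Lc : ℤ) • t) (v := -((Lc : ℤ) • t))
    (A := fun κ u κ' u' => (cE₂ * (Lc : ℝ) ^ (2 * (d + 1))) •
          mmRead Lc (K3OfK (unitK (sfStep Lc j) (smStep d Lc j) (KInvStep (d := d) Lc j)) Lc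
            (unitS (sfStep Lc j) (smStep d Lc j) (Spure d Lc cE cVH cΛ j)) (unitM (sfStep Lc j) (smStep d Lc j) (M1 d Lc cΛ j))
            (W2SymOfK (unitK (sfStep Lc j) (smStep d Lc j) (KInvStep (d := d) Lc j)) Lc
              (unitS (sfStep Lc j) (smStep d Lc j) (Spure d Lc cE cVH cΛ j)) (unitM (sfStep Lc j) (smStep d Lc j) (M1 d Lc cΛ j)) 0
              (unitM₂ (sfStep Lc j) (smStep d Lc j) (M2Of d Lc mixFF j))) κ u κ' u'))
    (B := fun κ u κ' u' => cB • mfNeg (vh₂S κ u κ' u'))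
    (fun κ u κ' u' => bracketVal_translate hLc cE cVH cΛ hmixt cE₂ j κ u κ' u' ((Lc : ℤ) • t))
    (fun κ u κ' u' => border_translate_block hBt cB t κ u κ' u') κ u κ' u'

end Generic

/-- [folklore] **`bracket_translate_block` AT an1's TABLES, ANY ROOTS** (`vh₂S := vh₂SAt ρ Lc`, `mixFF := mixFFAt ρ′ Lc`): NO binder left
(an1's `vh₂SAt_translate`, `mixFFAt_translate`). -/
theorem bracket_translate_block_an1 (hLc : 1 ≤ Lc) (ρ ρ' : Fin (d + 1) → ℤ) (cE cVH cΛ cE₂ cB : ℝ) (j : ℕ) (κ : Fin (d + 1))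
    (u : Fin (d + 1) → ℤ) (κ' : Fin (d + 1)) (u' t : Fin (d + 1) → ℤ) :
    (fun κ u κ' u' => (cE₂ * (Lc : ℝ) ^ (2 * (d + 1))) •
          mmRead Lc (K3OfK (unitK (sfStep Lc j) (smStep d Lc j) (KInvStep (d := d) Lc j)) Lc
            (unitS (sfStep Lc j) (smStep d Lc j) (Spure d Lc cE cVH cΛ j)) (unitM (sfStep Lc j) (smStep d Lc j) (M1 d Lc cΛ j))
            (W2SymOfK (unitK (sfStep Lc j) (smStep d Lc j) (KInvStep (d := d) Lc j)) Lc
              (unitS (sfStep Lc j) (smStep d Lc j) (Spure d Lc cE cVH cΛ j)) (unitM (sfStep Lc j) (smStep d Lc j) (M1 d Lc cΛ j)) 0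
              (unitM₂ (sfStep Lc j) (smStep d Lc j) (M2Of d Lc (mixFFAt ρ' Lc) j))) κ u κ' u')
        + cB • mfNeg (vh₂SAt ρ Lc κ u κ' u')) κ (u + (Lc : ℤ) • t) κ' (u' + (Lc : ℤ) • t)
      = shiftK (-((Lc : ℤ) • t)) ((fun κ u κ' u' => (cE₂ * (Lc : ℝ) ^ (2 * (d + 1))) •
          mmRead Lc (K3OfK (unitK (sfStep Lc j) (smStep d Lc j) (KInvStep (d := d) Lc j)) Lc
            (unitS (sfStep Lc j) (smStep d Lc j) (Spure d Lc cE cVH cΛ j)) (unitM (sfStep Lc j) (smStep d Lc j) (M1 d Lc cΛ j))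
            (W2SymOfK (unitK (sfStep Lc j) (smStep d Lc j) (KInvStep (d := d) Lc j)) Lc
              (unitS (sfStep Lc j) (smStep d Lc j) (Spure d Lc cE cVH cΛ j)) (unitM (sfStep Lc j) (smStep d Lc j) (M1 d Lc cΛ j)) 0
              (unitM₂ (sfStep Lc j) (smStep d Lc j) (M2Of d Lc (mixFFAt ρ' Lc) j))) κ u κ' u')
        + cB • mfNeg (vh₂SAt ρ Lc κ u κ' u')) κ u κ' u') :=
  bracket_translate_block hLc cE cVH cΛ (mixFFAt_translate ρ' Lc) (vh₂SAt_translate hLc ρ) cE₂ cB j κ u κ' u' t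

/-- [folklore] **`bracket_translate_block` IN THE ROW's LITERAL BASE-ROOT TEXT** (`vh₂S d Lc`; generic `mixFF` under its one covariance
binder `hmixt`). -/
theorem bracket_translate_block_base (hLc : 1 ≤ Lc) (cE cVH cΛ cE₂ cB : ℝ) {mixFF : Tab d}
    (hmixt : ∀ (κ : Fin (d + 1)) (u : Fin (d + 1) → ℤ) (ρ : Fin (d + 1)) (w t : Fin (d + 1) → ℤ),
      mixFF κ (u + (Lc : ℤ) • t) ρ (w + t) = shiftK (-((Lc : ℤ) • t)) (mixFF κ u ρ w))
    (j : ℕ) (κ : Fin (d + 1)) (u : Fin (d + 1) → ℤ) (κ' : Fin (d + 1)) (u' t : Fin (d + 1) → ℤ) :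
    (fun κ u κ' u' => (cE₂ * (Lc : ℝ) ^ (2 * (d + 1))) •
          mmRead Lc (K3OfK (unitK (sfStep Lc j) (smStep d Lc j) (KInvStep (d := d) Lc j)) Lc
            (unitS (sfStep Lc j) (smStep d Lc j) (Spure d Lc cE cVH cΛ j)) (unitM (sfStep Lc j) (smStep d Lc j) (M1 d Lc cΛ j))
            (W2SymOfK (unitK (sfStep Lc j) (smStep d Lc j) (KInvStep (d := d) Lc j)) Lc
              (unitS (sfStep Lc j) (smStep d Lc j) (Spure d Lc cE cVH cΛ j)) (unitM (sfStep Lc j) (smStep d Lc j) (M1 d Lc cΛ j)) 0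
              (unitM₂ (sfStep Lc j) (smStep d Lc j) (M2Of d Lc mixFF j))) κ u κ' u')
        + cB • mfNeg (vh₂S d Lc κ u κ' u')) κ (u + (Lc : ℤ) • t) κ' (u' + (Lc : ℤ) • t)
      = shiftK (-((Lc : ℤ) • t)) ((fun κ u κ' u' => (cE₂ * (Lc : ℝ) ^ (2 * (d + 1))) •
          mmRead Lc (K3OfK (unitK (sfStep Lc j) (smStep d Lc j) (KInvStep (d := d) Lc j)) Lc
            (unitS (sfStep Lc j) (smStep d Lc j) (Spure d Lc cE cVH cΛ j)) (unitM (sfStep Lc j) (smStep d Lc j) (M1 d Lc cΛ j))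
            (W2SymOfK (unitK (sfStep Lc j) (smStep d Lc j) (KInvStep (d := d) Lc j)) Lc
              (unitS (sfStep Lc j) (smStep d Lc j) (Spure d Lc cE cVH cΛ j)) (unitM (sfStep Lc j) (smStep d Lc j) (M1 d Lc cΛ j)) 0
              (unitM₂ (sfStep Lc j) (smStep d Lc j) (M2Of d Lc mixFF j))) κ u κ' u')
        + cB • mfNeg (vh₂S d Lc κ u κ' u')) κ u κ' u') :=
  bracket_translate_block hLc cE cVH cΛ hmixt (vh₂S_translate hLc) cE₂ cB j κ u κ' u' t

end Summit.QuantumFields.BalabanUV.Beta.GAN24.T2OfBracketBlockCovariance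

end
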